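import Literature.Algebra.Polynomial.CircuitNormMinimiser

/-!
# The AGE (relative-entropy) certificate of a circuit: the explicit witness `ν = Θ·λ`

[cite: ChandrasekaranShah2016, §2.1: the certificate conditions (relent) «`D(ν, e c) − β ≤ 0`,
`ν ∈ ℝ^ℓ_+`, `Q ν = (1'ν) α`», the chain «(iii) `∏ (c_j/(ν_j/1'ν))^{ν_j/1'ν} = exp{−D(ν/1'ν, c)}`
(iv) `≥ −ξ[D(ν/1'ν, c) + log ξ − 1] ∀ ξ ∈ ℝ_+` (v) `= −ξ D(ν/1'ν, (e/ξ) c)` (vi) `= −D(ξν/1'ν, e c)`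
(vii) `≥ −D(ν, e c)`» («inequality (vii) follows by setting `ξ = 1'ν`»), the GP parametrisation
(relentgp) «`D(ν, c) + log(−β) ≤ 0`, `ν ∈ ℝ^ℓ_+`, `1'ν = 1`, `Qν = α`», and Lemma 2 («If `g(x) ≥ 0`
for all `x ∈ ℝⁿ` then there exists `ν ∈ ℝ^ℓ` satisfying the conditions (relent)», proved there «as
a consequence of strong duality applied to a suitable convex program»)]
[cite: MagronSeidlerDewolff2019, Lemma 2.3 («Let `p(x) = ∑_{j=1}^t c_j exp(α(j)·x) +
β exp(α(0)·x)`, with `c_1, …, c_t ∈ ℚ_{>0}` … Then `p(x) ≥ 0` for all `x ∈ ℝⁿ` if and only if there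
exists `ν ∈ ℝ^t_+` such that `D(ν, e c) ≤ β` and `∑_j α(j) ν_j = (1·ν) α(0)`.»)]
[cite: MurrayChandrasekaranWierman2021, §2.1 (display (ageRelEnt): «some `ν ∈ ℝ^{[m]∖k}_+`
satisfies `[α_{∖k} − α_k 1ᵀ]ν = 0` and `D(ν, e c_{∖k}) ≤ c_k`») and §5.3 («Agiforms have AGE
signomial representatives, which follows by plugging `ν = λ` into (ageRelEnt)»; «a polynomial
admits a SAGE certificate if and only if it admits a SONC certificate»)]

For a *circuit* — positive outer coefficients `b_j`, inner exponent `β = ∑_j λ_j α(j)` with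
positive barycentric coordinates `λ` — the tree has two certificates of the nonnegativity of
`g(x) = ∑_j b_j e^{α(j)·x} + c e^{β·x}`: the circuit-number test `−Θ(b, λ) ≤ c`
(`CircuitNumberNonnegativity.signomial_nonneg_of_neg_circuitNumber_le`, complete by
`CircuitNormMinimiser.signomial_nonneg_iff`) and the AGE / relative-entropy test «some `ν ≥ 0`
with `∑ ν_j α(j) = (1'ν) β` has `D(ν, e b) ≤ c`» (`signomial_nonneg_of_vecRelEntropy_le`, with
`neg_circuitNumber_le_vecRelEntropy`: every such `ν` has `−Θ(b, ν/1'ν) ≤ D(ν, e b)`).  This file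
makes the passage between them explicit and thereby proves the completeness of the AGE test on
circuits without any duality argument:

* along the ray `ν = s·λ` (`s > 0`) the relative entropy is `D(sλ, e b) = s(log s − 1) − s log Θ`
  (`vecRelEntropy_smul_weights`; `D(λ, b) = −log Θ`, `vecRelEntropy_weights`, is step (iii) of
  the source), it is `≥ −Θ` with equality **exactly at `s = Θ`**
  (`vecRelEntropy_smul_weights_eq_neg_circuitNumber_iff`) — steps (iv)–(vii) of
  [ChandrasekaranShah2016, §2.1] with the optimal `ξ`;
* hence `−Θ ≤ c` yields the AGE certificate `ν = Θ·λ` (`exists_ageCertificate_of_le`: the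
  circuit-level content of «SONC certificates are SAGE certificates», the remark «plugging `ν = λ`»
  of [MurrayChandrasekaranWierman2021, §5.3] being the case `Θ = 1`);
* on a simplicial circuit (affinely independent `α(j)`) the two tests are *equivalent*
  (`exists_ageCertificate_iff_neg_circuitNumber_le`) and equivalent to nonnegativity
  (`signomial_nonneg_iff_exists_ageCertificate`) — [MagronSeidlerDewolff2019, Lemma 2.3] =
  [ChandrasekaranShah2016, Lemma 2] for circuit supports, both directions, with an explicit
  witness in place of strong duality;
* the GP form of the test, `D(λ, b) + log(−c) ≤ 0` for `c < 0`, is literally `−Θ ≤ c`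
  (`gpCertificate_iff`).

All statements are fully proved; no named facts.  The general Lemma 2 / Lemma 2.3 (arbitrary
supports, several outer terms not forming a simplex) is *not* formalised here: it needs the
conjugate-duality argument of the source.
-/

namespace Literature.Algebra.Polynomial.CircuitAgeCertificate

open Finset Matrix Literature.Algebra.Polynomial.CircuitNumberNonnegativity
  Literature.Algebra.Polynomial.CircuitNormMinimiser

variable {ι : Type*} [Fintype ι] {n : Type*} [Fintype n]

/-! ## The relative entropy along the ray `ν = s·λ` -/

section Ray

/-- Step (iii) of the source for normalised weights: `D(λ, b) = −log Θ(b, λ)` (`b, λ > 0`,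
`∑ λ_j = 1`), i.e. `Θ = exp(−D(λ, b))`.
[cite: ChandrasekaranShah2016, §2.1, equation (iii) («∏ (c_j/(ν_j/1'ν))^{ν_j/1'ν} =
exp{−D(ν/1'ν, c)}»)] -/
theorem vecRelEntropy_weights {b w : ι → ℝ} (hb : ∀ j, 0 < b j) (hw : ∀ j, 0 < w j)
    (hw1 : ∑ j, w j = 1) : vecRelEntropy w b = -Real.log (circuitNumber b w) := by
  have hΘ : 0 < circuitNumber b w := circuitNumber_pos hb hw
  have h0 := sum_mul_log_share_eq_zero hb hw hw1
  have hj : ∀ j, Real.log (w j * circuitNumber b w / b j)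
      = Real.log (w j / b j) + Real.log (circuitNumber b w) := fun j => by
    rw [mul_div_right_comm, Real.log_mul (div_pos (hw j) (hb j)).ne' hΘ.ne']
  simp_rw [hj, mul_add, sum_add_distrib, ← sum_mul, hw1, one_mul] at h0
  unfold vecRelEntropy
  linarith

/-- `Θ(b, λ) = exp(−D(λ, b))`.
[cite: ChandrasekaranShah2016, §2.1, equation (iii)] -/
theorem circuitNumber_eq_exp_neg_vecRelEntropy {b w : ι → ℝ} (hb : ∀ j, 0 < b j)
    (hw : ∀ j, 0 < w j) (hw1 : ∑ j, w j = 1) :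
    circuitNumber b w = Real.exp (-vecRelEntropy w b) := by
  rw [vecRelEntropy_weights hb hw hw1, neg_neg, Real.exp_log (circuitNumber_pos hb hw)]

/-- **The relative entropy along the ray** `ν = s·λ`: for `s > 0`,
`D(sλ, e b) = s(log s − 1) − s log Θ(b, λ)` (positive homogeneity of `D`, steps (v)–(vi)).
[cite: ChandrasekaranShah2016, §2.1, equations (v)–(vi) («by noting that this function is
positively homogenous»)] -/
theorem vecRelEntropy_smul_weights {b w : ι → ℝ} (hb : ∀ j, 0 < b j) (hw : ∀ j, 0 < w j)
    (hw1 : ∑ j, w j = 1) {s : ℝ} (hs : 0 < s) :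
    vecRelEntropy (fun j => s * w j) (fun j => Real.exp 1 * b j)
      = s * (Real.log s - 1) - s * Real.log (circuitNumber b w) := by
  have hj : ∀ j, s * w j * Real.log (s * w j / (Real.exp 1 * b j))
      = s * (w j * Real.log (w j / b j)) + s * (Real.log s - 1) * w j := fun j => by
    rw [mul_div_mul_comm, Real.log_mul (div_pos hs (Real.exp_pos 1)).ne'
      (div_pos (hw j) (hb j)).ne', Real.log_div hs.ne' (Real.exp_pos 1).ne', Real.log_exp]
    ring
  unfold vecRelEntropy
  simp_rw [hj, sum_add_distrib, ← mul_sum, hw1, mul_one]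
  have h := vecRelEntropy_weights hb hw hw1
  unfold vecRelEntropy at h
  rw [h]
  ring

/-- Along the ray the relative entropy is bounded below by `−Θ`: `−Θ(b, λ) ≤ D(sλ, e b)` for every
`s > 0` (steps (iv)–(vii); the general statement for arbitrary `ν ≥ 0` is
`CircuitNumberNonnegativity.neg_circuitNumber_le_vecRelEntropy`).
[cite: ChandrasekaranShah2016, §2.1, (iv)–(vii)] -/
theorem neg_circuitNumber_le_vecRelEntropy_smul_weights {b w : ι → ℝ} (hb : ∀ j, 0 < b j)
    (hw : ∀ j, 0 < w j) (hw1 : ∑ j, w j = 1) {s : ℝ} (hs : 0 < s) :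
    -circuitNumber b w ≤ vecRelEntropy (fun j => s * w j) (fun j => Real.exp 1 * b j) := by
  have hΘ : 0 < circuitNumber b w := circuitNumber_pos hb hw
  rw [vecRelEntropy_smul_weights hb hw hw1 hs]
  have hlog := Real.log_le_sub_one_of_pos (div_pos hΘ hs)
  rw [Real.log_div hΘ.ne' hs.ne'] at hlog
  have h := mul_le_mul_of_nonneg_left hlog hs.le
  have h' : s * (circuitNumber b w / s - 1) = circuitNumber b w - s := by field_simp
  rw [h'] at h
  nlinarith

/-- … with **equality exactly at `s = Θ`**: `D(sλ, e b) = −Θ(b, λ) ↔ s = Θ(b, λ)` (`s > 0`).  So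
`ν = Θ·λ` is the optimal certificate on the ray, the choice `ξ = e^{−ρ}` making (iv) an equality.
[cite: ChandrasekaranShah2016, §2.1, (iv) («exp{−ρ} = sup_{ξ ∈ ℝ_+} −ξ[ρ + log(ξ) − 1]») and
(vii)] -/
theorem vecRelEntropy_smul_weights_eq_neg_circuitNumber_iff {b w : ι → ℝ} (hb : ∀ j, 0 < b j)
    (hw : ∀ j, 0 < w j) (hw1 : ∑ j, w j = 1) {s : ℝ} (hs : 0 < s) :
    vecRelEntropy (fun j => s * w j) (fun j => Real.exp 1 * b j) = -circuitNumber b w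
      ↔ s = circuitNumber b w := by
  have hΘ : 0 < circuitNumber b w := circuitNumber_pos hb hw
  rw [vecRelEntropy_smul_weights hb hw hw1 hs]
  constructor
  · intro h
    by_contra hne
    have hne' : circuitNumber b w / s ≠ 1 := fun h1 => hne (by
      rw [div_eq_one_iff_eq hs.ne'] at h1; exact h1.symm)
    have hlog := Real.log_lt_sub_one_of_pos (div_pos hΘ hs) hne'
    rw [Real.log_div hΘ.ne' hs.ne'] at hlog
    have h2 := mul_lt_mul_of_pos_left hlog hs
    have h' : s * (circuitNumber b w / s - 1) = circuitNumber b w - s := by field_simp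
    rw [h'] at h2
    nlinarith
  · rintro rfl
    ring

end Ray

/-! ## The explicit AGE certificate of a circuit -/

section Certificate

omit [Fintype n] in
/-- The balance condition `∑_j ν_j α(j) = (1'ν) β` holds for every multiple `ν = s·λ` of the
barycentric coordinates of `β = ∑_j λ_j α(j)` (`∑ λ_j = 1`).
[cite: ChandrasekaranShah2016, §2.1, condition «Q ν = (1'ν) α» of (relent)] -/
theorem ageBalance_smul_weights {w : ι → ℝ} (hw1 : ∑ j, w j = 1) {α : ι → n → ℝ} {β : n → ℝ}
    (hβ : ∀ i, β i = ∑ j, w j * α j i) (s : ℝ) (i : n) :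
    ∑ j, s * w j * α j i = (∑ j, s * w j) * β i := by
  rw [← mul_sum, hw1, mul_one, hβ i, mul_sum]
  exact sum_congr rfl fun j _ => by ring

omit [Fintype n] in
/-- **A circuit-number certificate is an AGE certificate, explicitly.**  If `b, λ > 0`,
`∑ λ_j = 1`, `β = ∑ λ_j α(j)` and `−Θ(b, λ) ≤ c`, then `ν = Θ·λ` is a relative-entropy
certificate for `g = ∑ b_j e^{α(j)·x} + c e^{β·x}`: `ν ≥ 0`, `∑ ν_j α(j) = (1'ν) β` and
`D(ν, e b) = −Θ ≤ c`.  (For an agiform, `b = λ` and `Θ = 1`, this is the source's `ν = λ`.)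
[cite: MurrayChandrasekaranWierman2021, §5.3 («Agiforms have AGE signomial representatives,
which follows by plugging ν = λ into (ageRelEnt)»; «a polynomial admits a SAGE certificate if and
only if it admits a SONC certificate»)]
[cite: ChandrasekaranShah2016, §2.1, (iv)–(vii) with ξ = 1'ν optimal] -/
theorem exists_ageCertificate_of_le {b w : ι → ℝ} (hb : ∀ j, 0 < b j) (hw : ∀ j, 0 < w j)
    (hw1 : ∑ j, w j = 1) {α : ι → n → ℝ} {β : n → ℝ} (hβ : ∀ i, β i = ∑ j, w j * α j i)
    {c : ℝ} (hc : -circuitNumber b w ≤ c) :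
    ∃ ν : ι → ℝ, (∀ j, 0 ≤ ν j) ∧ (∀ i, ∑ j, ν j * α j i = (∑ j, ν j) * β i)
      ∧ vecRelEntropy ν (fun j => Real.exp 1 * b j) ≤ c := by
  have hΘ : 0 < circuitNumber b w := circuitNumber_pos hb hw
  refine ⟨fun j => circuitNumber b w * w j, fun j => (mul_pos hΘ (hw j)).le,
    ageBalance_smul_weights hw1 hβ _, ?_⟩
  rw [(vecRelEntropy_smul_weights_eq_neg_circuitNumber_iff hb hw hw1 hΘ).mpr rfl]
  exact hc

/-- **On a simplicial circuit the AGE test and the circuit-number test are the same test**: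
for affinely independent `α(j)`, `b, λ > 0`, `β = ∑ λ_j α(j)`, an AGE certificate exists iff
`−Θ(b, λ) ≤ c`.  (`⇒`: an AGE certificate proves `g ≥ 0`, which forces `−Θ ≤ c` by the
equalising point; `⇐`: the explicit witness.)
[cite: MurrayChandrasekaranWierman2021, §5.3 («a polynomial admits a SAGE certificate if and
only if it admits a SONC certificate»; «while Paneta et al. and Iliman and de Wolff consider the
weights λ as fixed (given by barycentric coordinates), the analogous quantity ν in the SAGE
approach is an optimization variable»)]
[cite: MagronSeidlerDewolff2019, Lemma 2.3 and Theorem 2.1] -/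
theorem exists_ageCertificate_iff_neg_circuitNumber_le {b w : ι → ℝ} (hb : ∀ j, 0 < b j)
    (hw : ∀ j, 0 < w j) (hw1 : ∑ j, w j = 1) {α : ι → n → ℝ} (hα : AffineIndependent ℝ α)
    {β : n → ℝ} (hβ : ∀ i, β i = ∑ j, w j * α j i) {c : ℝ} :
    (∃ ν : ι → ℝ, (∀ j, 0 ≤ ν j) ∧ (∀ i, ∑ j, ν j * α j i = (∑ j, ν j) * β i)
      ∧ vecRelEntropy ν (fun j => Real.exp 1 * b j) ≤ c) ↔ -circuitNumber b w ≤ c := by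
  refine ⟨fun ⟨ν, hν, hbal, hD⟩ => ?_, exists_ageCertificate_of_le hb hw hw1 hβ⟩
  exact (signomial_nonneg_iff hb hw hw1 hα hβ).mp
    (signomial_nonneg_of_vecRelEntropy_le hb hν hbal hD)

/-- **Lemma 2.3 of Magron–Seidler–de Wolff = Lemma 2 of Chandrasekaran–Shah, for circuit
supports, in both directions**: with `b, λ > 0`, affinely independent `α(j)` and `β = ∑ λ_j α(j)`,
`∑_j b_j e^{α(j)·x} + c e^{β·x} ≥ 0` for all `x ∈ ℝⁿ` **iff** some `ν ∈ ℝ^t_{≥0}` satisfies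
`∑_j ν_j α(j) = (1'ν) β` and `D(ν, e b) ≤ c`.  The `if` half is the AM/GM chain of the companion
file; the `only if` half is proved here with the explicit witness `ν = Θ·λ` (the source invokes
strong duality).
[cite: MagronSeidlerDewolff2019, Lemma 2.3]
[cite: ChandrasekaranShah2016, Lemma 2 and §2.1 («the existence of ν … certifies the
nonnegativity of the signomial g»)] -/
theorem signomial_nonneg_iff_exists_ageCertificate {b w : ι → ℝ} (hb : ∀ j, 0 < b j)
    (hw : ∀ j, 0 < w j) (hw1 : ∑ j, w j = 1) {α : ι → n → ℝ} (hα : AffineIndependent ℝ α)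
    {β : n → ℝ} (hβ : ∀ i, β i = ∑ j, w j * α j i) {c : ℝ} :
    (∀ x : n → ℝ, 0 ≤ ∑ j, b j * Real.exp (α j ⬝ᵥ x) + c * Real.exp (β ⬝ᵥ x))
      ↔ ∃ ν : ι → ℝ, (∀ j, 0 ≤ ν j) ∧ (∀ i, ∑ j, ν j * α j i = (∑ j, ν j) * β i)
          ∧ vecRelEntropy ν (fun j => Real.exp 1 * b j) ≤ c := by
  rw [signomial_nonneg_iff hb hw hw1 hα hβ, exists_ageCertificate_iff_neg_circuitNumber_le hb hw
    hw1 hα hβ]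

/-- The explicit certificate, read back through soundness: `−Θ ≤ c` proves `g ≥ 0` *via* the
relative-entropy route (no affine independence needed in this direction).
[cite: ChandrasekaranShah2016, §2.1 (chain (i)–(viii))]
[cite: MagronSeidlerDewolff2019, Lemma 2.3 (⇐)] -/
theorem signomial_nonneg_of_le_via_ageCertificate {b w : ι → ℝ} (hb : ∀ j, 0 < b j)
    (hw : ∀ j, 0 < w j) (hw1 : ∑ j, w j = 1) {α : ι → n → ℝ} {β : n → ℝ}
    (hβ : ∀ i, β i = ∑ j, w j * α j i) {c : ℝ} (hc : -circuitNumber b w ≤ c) (x : n → ℝ) :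
    0 ≤ ∑ j, b j * Real.exp (α j ⬝ᵥ x) + c * Real.exp (β ⬝ᵥ x) := by
  obtain ⟨ν, hν, hbal, hD⟩ := exists_ageCertificate_of_le hb hw hw1 hβ hc
  exact signomial_nonneg_of_vecRelEntropy_le hb hν hbal hD x

end Certificate

/-! ## The GP form of the certificate -/

section GeometricProgramming

/-- **The GP parametrisation on a circuit.**  For an inner coefficient `c < 0` the condition
«`D(ν, b) + log(−c) ≤ 0`, `1'ν = 1`, `Qν = β`» of the source with `ν = λ` (the unique normalised
balanced vector on a simplicial circuit) reads `D(λ, b) + log(−c) ≤ 0`, and since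
`D(λ, b) = −log Θ` it is *literally* the circuit-number test `−Θ ≤ c`.
[cite: ChandrasekaranShah2016, §2.1, display (relentgp) («D(ν, c) + log(−β) ≤ 0, ν ∈ ℝ^ℓ_+,
1'ν = 1, Qν = α»; «the parametrization (relentgp) is not jointly convex in (ν, c, β)»)] -/
theorem gpCertificate_iff {b w : ι → ℝ} (hb : ∀ j, 0 < b j) (hw : ∀ j, 0 < w j)
    (hw1 : ∑ j, w j = 1) {c : ℝ} (hc : c < 0) :
    vecRelEntropy w b + Real.log (-c) ≤ 0 ↔ -circuitNumber b w ≤ c := by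
  have hΘ : 0 < circuitNumber b w := circuitNumber_pos hb hw
  rw [vecRelEntropy_weights hb hw hw1, neg_add_le_iff_le_add, add_zero,
    Real.log_le_log_iff (neg_pos.mpr hc) hΘ]
  constructor <;> intro h <;> linarith

/-- Consequently, for `c < 0` on a simplicial circuit: `g ≥ 0` iff `D(λ, b) + log(−c) ≤ 0`.
[cite: ChandrasekaranShah2016, §2.1, (relentgp)] [cite: IlimanDewolff2016, Theorem 3.8] -/
theorem signomial_nonneg_iff_gpCertificate {b w : ι → ℝ} (hb : ∀ j, 0 < b j)
    (hw : ∀ j, 0 < w j) (hw1 : ∑ j, w j = 1) {α : ι → n → ℝ} (hα : AffineIndependent ℝ α)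
    {β : n → ℝ} (hβ : ∀ i, β i = ∑ j, w j * α j i) {c : ℝ} (hc : c < 0) :
    (∀ x : n → ℝ, 0 ≤ ∑ j, b j * Real.exp (α j ⬝ᵥ x) + c * Real.exp (β ⬝ᵥ x))
      ↔ vecRelEntropy w b + Real.log (-c) ≤ 0 := by
  rw [signomial_nonneg_iff hb hw hw1 hα hβ, gpCertificate_iff hb hw hw1 hc]

end GeometricProgramming

end Literature.Algebra.Polynomial.CircuitAgeCertificate
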